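import Literature.RingTheory.Length.LengthEqFinrank
import Mathlib.RingTheory.Spectrum.Prime.Noetherian
import Mathlib.RingTheory.Artinian.Ring
import Mathlib.RingTheory.TensorProduct.Basic
import Mathlib.RingTheory.Localization.AtPrime.Basic
import Mathlib.LinearAlgebra.Dimension.Constructions
import Mathlib.FieldTheory.IsAlgClosed.Basic
import HarnessLib

/-!
# Lengths of the local factors of the geometric fibre `Ω ⊗_V C` of a finite free algebra add up to its rank
# ([StacksProject] Tag 00JA (artinian ring = product of its localisations), Tag 02M0; [Fulton1998] App. A.1, Lemma A.1.3 and Ex. A.1.1)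

Topic `Literature/RingTheory/Length`, namespace `Literature.RingTheory.Length`.  THEOREMS only (no def, no instance, no notation, no named
fact, no `sorry`); imports ★ `Length/LengthEqFinrank` + Mathlib.  Cell `hodgecm-mathlib` (D-0151), FLOOR 0, programme F0P5a, crux item
stmt-HodgeConjecture-24832 — row **(γ2′-alg)** «MULTIPLICITY version of the (S-γ2) generic-fibre count, WITHOUT `hred`» (F0P5a-p05 (g2) census
`F0/P5a/C3-LEVELS-census.v1` §3 (A); F0P5a-plan (g2) 2026-08-31T01:32:49Z: the weights `e_y` of row Γ3-A′ `TwoSectionPushforwardWeighted`).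

SETTING: `V` a commutative ring, `C` a module-finite FREE `V`-algebra (the fibre algebra `Γ(𝒯 ×_𝒮 Spec R, ⊤)` of a finite flat cover,
★ `Morphisms.moduleFree_sections_pullback`), `Ω` a field under `V` (the algebraic closure of the generic point).  The GEOMETRIC GENERIC FIBRE
is the finite-dimensional, hence artinian, `Ω`-algebra `A := Ω ⊗[V] C`; its points are its finitely many maximal ideals `𝔫`, and the
MULTIPLICITY of the point `𝔫` is the length of the artinian local ring `A_𝔫` — equivalently (`Ω` algebraically closed) `dim_Ω A_𝔫`.

* §1 `sum_finrank_localization_eq_finrank` — **`∑_𝔫 dim_Ω A_𝔫 = rank_V C`** (`A ≅ Π_𝔫 A_𝔫`, Mathlib `MaximalSpectrum.toPiLocalizationEquiv` for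
  the artinian `A`; `dim_Ω A = rank_V C` by free base change);
* §2 `length_localization_eq_finrank` — for `Ω` ALGEBRAICALLY CLOSED the multiplicity is a length: `ℓ(A_𝔫) = dim_Ω A_𝔫` (residue field of
  `A_𝔫` is `Ω`; ★ `length_eq_finrank_of_residueField`), hence **`∑_𝔫 ℓ(A_𝔫) = rank_V C`** (`sum_length_localization_eq_finrank`);
* §3 the points: `φ ↦ ker φ̃` (`φ̃ = AlgHom.liftEquiv φ : A →ₐ[Ω] Ω`) is a BIJECTION `(C →ₐ[V] Ω) ≃ MaximalSpectrum A` for `Ω` algebraically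
  closed (`bijective_kerMax_liftEquiv`), so the multiplicities are indexed by the `Ω`-valued points of `C` and still add up to `rank_V C`
  (`finsum_finrank_localization_algHom_eq_finrank`).  When `A` is reduced every `A_𝔫` is the field `Ω` and all multiplicities are `1`
  (the étale case ★ `Literature.RingTheory.Etale.card_algHom_eq_finrank_of_isReduced_baseChange`; not re-derived here).

HC_CM is proved only modulo the 7 printed citations until rung 0 closes; this file is a generic leaf and changes no count.

## References
* [StacksProject] The Stacks Project, Tag 00JA (a ring with finite discrete spectrum is the product of its localisations at maximal
  ideals), Tag 02M0 (length and rank for finite algebras over local rings), Tag 00U3.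
* [Fulton1998] W. Fulton, *Intersection Theory*, 2nd ed. (1998), Appendix A.1, Lemma A.1.3 and Example A.1.1 (length = dimension over the
  ground field when the residue field is the ground field; additivity over the points of a finite scheme).
-/

set_option autoImplicit false

noncomputable section

open IsLocalRing Module TensorProduct

universe u v w

namespace Literature.RingTheory.Length

/-! ### §0 Points of a finite algebra over an algebraically closed field: `AlgHom`s ↔ maximal ideals -/

section Points

variable (Ω : Type u) [Field Ω] (A : Type v) [CommRing A] [Algebra Ω A]

/-- An `Ω`-algebra map `A → Ω` is surjective (it is the identity on scalars). [folklore] -/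
private theorem algHom_surjective (φ : A →ₐ[Ω] Ω) : Function.Surjective φ :=
  fun c => ⟨algebraMap Ω A c, φ.commutes c⟩

/-- The kernel of an `Ω`-algebra map `A → Ω` is a maximal ideal. [cite: StacksProject, Tag 00U3] -/
theorem isMaximal_ker_algHom (φ : A →ₐ[Ω] Ω) : (RingHom.ker φ).IsMaximal :=
  RingHom.ker_isMaximal_of_surjective φ (algHom_surjective Ω A φ)

/-- An `Ω`-algebra map `A → Ω` is determined by its kernel: `φ a` is the unique scalar congruent to `a` modulo `ker φ`.
[cite: StacksProject, Tag 00U3] -/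
theorem algHom_eq_of_ker_eq {φ ψ : A →ₐ[Ω] Ω} (h : RingHom.ker φ = RingHom.ker ψ) : φ = ψ := by
  ext a
  have ha : ψ (a - algebraMap Ω A (φ a)) = 0 := by
    rw [← RingHom.mem_ker, ← h, RingHom.mem_ker, map_sub, AlgHom.commutes, Algebra.algebraMap_self_apply, sub_self]
  rw [map_sub, AlgHom.commutes, Algebra.algebraMap_self_apply, sub_eq_zero] at ha
  exact ha.symm

/-- Over an ALGEBRAICALLY CLOSED field every maximal ideal of a module-finite algebra is the kernel of an `Ω`-algebra map to `Ω` (the residue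
field is a finite, hence trivial, extension of `Ω`; Mathlib `IsAlgClosed.algebraMap_bijective_of_isIntegral`). [cite: StacksProject, Tag 00U3] -/
theorem exists_algHom_ker_eq [IsAlgClosed Ω] [Module.Finite Ω A] (𝔫 : MaximalSpectrum A) :
    ∃ φ : A →ₐ[Ω] Ω, RingHom.ker φ = 𝔫.asIdeal := by
  haveI : 𝔫.asIdeal.IsMaximal := 𝔫.isMaximal
  letI : Field (A ⧸ 𝔫.asIdeal) := Ideal.Quotient.field 𝔫.asIdeal
  haveI : Algebra.IsIntegral Ω (A ⧸ 𝔫.asIdeal) := Algebra.IsIntegral.of_finite Ω _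
  let e : Ω ≃ₐ[Ω] (A ⧸ 𝔫.asIdeal) := AlgEquiv.ofBijective (Algebra.ofId Ω (A ⧸ 𝔫.asIdeal))
    (IsAlgClosed.algebraMap_bijective_of_isIntegral (k := Ω) (K := A ⧸ 𝔫.asIdeal))
  refine ⟨(e.symm : (A ⧸ 𝔫.asIdeal) →ₐ[Ω] Ω).comp (Ideal.Quotient.mkₐ Ω 𝔫.asIdeal), ?_⟩
  ext a
  rw [RingHom.mem_ker, AlgHom.comp_apply, Ideal.Quotient.mkₐ_eq_mk,
    show ((e.symm : (A ⧸ 𝔫.asIdeal) →ₐ[Ω] Ω)) (Ideal.Quotient.mk 𝔫.asIdeal a) = e.symm (Ideal.Quotient.mk 𝔫.asIdeal a) from rfl,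
    EmbeddingLike.map_eq_zero_iff, Ideal.Quotient.eq_zero_iff_mem]

/-- **Points = maximal ideals**: for a module-finite algebra `A` over an algebraically closed field `Ω`, `φ ↦ ker φ` is a BIJECTION from the
`Ω`-algebra maps `A → Ω` onto `MaximalSpectrum A`. [cite: StacksProject, Tag 00U3] -/
theorem bijective_kerMax [IsAlgClosed Ω] [Module.Finite Ω A] :
    Function.Bijective (fun φ : A →ₐ[Ω] Ω => (⟨RingHom.ker φ, isMaximal_ker_algHom Ω A φ⟩ : MaximalSpectrum A)) := by
  refine ⟨fun φ ψ h => algHom_eq_of_ker_eq Ω A (congrArg MaximalSpectrum.asIdeal h), fun 𝔫 => ?_⟩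
  obtain ⟨φ, hφ⟩ := exists_algHom_ker_eq Ω A 𝔫
  exact ⟨φ, MaximalSpectrum.ext hφ⟩

end Points

/-! ### §1 The local factors of the geometric fibre and their dimensions -/

section Fibre

variable (V : Type u) [CommRing V] (C : Type u) [CommRing C] [Algebra V C] [Module.Finite V C] [Module.Free V C]
  (Ω : Type u) [Field Ω] [Algebra V Ω]

omit [Module.Free V C] in
/-- The geometric fibre `Ω ⊗[V] C` of a module-finite algebra is an artinian ring (finite-dimensional over the field `Ω`).
[cite: StacksProject, Tag 00JA] -/
theorem isArtinianRing_tensor : IsArtinianRing (Ω ⊗[V] C) :=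
  IsArtinianRing.of_finite Ω (Ω ⊗[V] C)

omit [Module.Free V C] in
/-- Hence it has finitely many maximal ideals (points of the geometric fibre). [cite: StacksProject, Tag 00JA] -/
theorem finite_maximalSpectrum_tensor : Finite (MaximalSpectrum (Ω ⊗[V] C)) := by
  haveI := isArtinianRing_tensor V C Ω
  infer_instance

omit [Module.Free V C] in
/-- Each local factor `(Ω ⊗[V] C)_𝔫` is a quotient of `Ω ⊗[V] C` (artinian rings surject onto their localisations), hence module-finite over `Ω`.
[cite: StacksProject, Tag 00JA] -/
theorem moduleFinite_localization (𝔫 : MaximalSpectrum (Ω ⊗[V] C)) : Module.Finite Ω (Localization.AtPrime 𝔫.asIdeal) := by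
  haveI := isArtinianRing_tensor V C Ω
  exact Module.Finite.of_surjective
    ((IsScalarTower.toAlgHom Ω (Ω ⊗[V] C) (Localization.AtPrime 𝔫.asIdeal)).toLinearMap)
    (IsArtinianRing.localization_surjective 𝔫.asIdeal.primeCompl (Localization.AtPrime 𝔫.asIdeal))

omit [Module.Finite V C] in
/-- `dim_Ω (Ω ⊗[V] C) = rank_V C` (free base change). [cite: StacksProject, Tag 02M0] -/
theorem finrank_tensor_eq_finrank : Module.finrank Ω (Ω ⊗[V] C) = Module.finrank V C := by
  haveI : Nontrivial V := (algebraMap V Ω).domain_nontrivial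
  exact Module.finrank_baseChange

/-- **The multiplicities add up to the rank**: `∑_𝔫 dim_Ω (Ω ⊗[V] C)_𝔫 = rank_V C`, the sum over the (finitely many) maximal ideals of the
geometric fibre — the artinian `Ω ⊗[V] C` is the product of its localisations (Mathlib `MaximalSpectrum.toPiLocalizationEquiv`, [StacksProject
00JA]) and `dim_Ω (Ω ⊗[V] C) = rank_V C`.  No reducedness is assumed: a non-reduced point contributes its full multiplicity.
[cite: StacksProject, Tag 00JA] [cite: Fulton1998, Appendix A.1, Example A.1.1] -/
theorem sum_finrank_localization_eq_finrank [Fintype (MaximalSpectrum (Ω ⊗[V] C))] :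
    ∑ 𝔫 : MaximalSpectrum (Ω ⊗[V] C), Module.finrank Ω (Localization.AtPrime 𝔫.asIdeal) = Module.finrank V C := by
  haveI := isArtinianRing_tensor V C Ω
  haveI : ∀ 𝔫 : MaximalSpectrum (Ω ⊗[V] C), Module.Finite Ω (Localization.AtPrime 𝔫.asIdeal) :=
    moduleFinite_localization V C Ω
  let e : (Ω ⊗[V] C) ≃ₗ[Ω] MaximalSpectrum.PiLocalization (Ω ⊗[V] C) :=
    (MaximalSpectrum.toPiLocalizationEquiv (Ω ⊗[V] C)).toLinearEquiv.restrictScalars Ω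
  rw [← finrank_tensor_eq_finrank V C Ω, e.finrank_eq, Module.finrank_pi_fintype]

end Fibre

/-! ### §2 Over an algebraically closed field the multiplicity is the length of the local factor -/

section Length

variable (Ω : Type u) [Field Ω] [IsAlgClosed Ω] (A : Type v) [CommRing A] [Algebra Ω A] [IsLocalRing A] [Module.Finite Ω A]

/-- Every element of a module-finite LOCAL algebra over an algebraically closed field is congruent to a scalar modulo the maximal ideal
(the residue field is a finite extension of `Ω`, hence `Ω`) — the hypothesis `hres` of ★ `length_eq_finrank_of_residueField`.
[cite: Fulton1998, Appendix A.1, Lemma A.1.3] -/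
theorem forall_exists_sub_algebraMap_mem_maximalIdeal (r : A) : ∃ c : Ω, r - algebraMap Ω A c ∈ maximalIdeal A := by
  haveI : Module.Finite Ω (ResidueField A) :=
    Module.Finite.of_surjective ((IsScalarTower.toAlgHom Ω A (ResidueField A)).toLinearMap) residue_surjective
  haveI : Algebra.IsIntegral Ω (ResidueField A) := Algebra.IsIntegral.of_finite Ω _
  obtain ⟨c, hc⟩ := (IsAlgClosed.algebraMap_bijective_of_isIntegral (k := Ω) (K := ResidueField A)).2 (residue A r)
  refine ⟨c, ?_⟩
  rw [← residue_eq_zero_iff, map_sub, sub_eq_zero, eq_comm]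
  rw [IsScalarTower.algebraMap_apply Ω A (ResidueField A)] at hc
  exact hc

/-- **Multiplicity = length** for a module-finite local algebra over an algebraically closed field: `ℓ_A(A) = dim_Ω A`.
[cite: Fulton1998, Appendix A.1, Lemma A.1.3] [cite: StacksProject, Tag 02M0] -/
theorem length_self_eq_finrank : Module.length A A = Module.finrank Ω A :=
  length_eq_finrank_of_residueField (forall_exists_sub_algebraMap_mem_maximalIdeal Ω A) A

end Length

section FibreLength

variable (V : Type u) [CommRing V] (C : Type u) [CommRing C] [Algebra V C] [Module.Finite V C] [Module.Free V C]
  (Ω : Type u) [Field Ω] [IsAlgClosed Ω] [Algebra V Ω]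

omit [Module.Free V C] in
/-- The multiplicity of the point `𝔫` of the geometric fibre is the length of the artinian local ring `(Ω ⊗[V] C)_𝔫`:
`ℓ((Ω ⊗ C)_𝔫) = dim_Ω (Ω ⊗ C)_𝔫`. [cite: Fulton1998, Appendix A.1, Lemma A.1.3] -/
theorem length_localization_eq_finrank (𝔫 : MaximalSpectrum (Ω ⊗[V] C)) :
    Module.length (Localization.AtPrime 𝔫.asIdeal) (Localization.AtPrime 𝔫.asIdeal) =
      Module.finrank Ω (Localization.AtPrime 𝔫.asIdeal) := by
  haveI := moduleFinite_localization V C Ω 𝔫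
  exact length_self_eq_finrank Ω (Localization.AtPrime 𝔫.asIdeal)

/-- **`∑_𝔫 ℓ((Ω ⊗_V C)_𝔫) = rank_V C`**: the lengths of the local rings of the geometric fibre of a finite free algebra at its (finitely many)
points add up to the rank — the multiplicity form of the generic-fibre count, valid without any reducedness (étaleness) hypothesis.
[cite: Fulton1998, Appendix A.1, Example A.1.1] [cite: StacksProject, Tag 00JA] -/
theorem sum_length_localization_eq_finrank [Fintype (MaximalSpectrum (Ω ⊗[V] C))] :
    ∑ 𝔫 : MaximalSpectrum (Ω ⊗[V] C), Module.length (Localization.AtPrime 𝔫.asIdeal) (Localization.AtPrime 𝔫.asIdeal) =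
      (Module.finrank V C : ℕ∞) := by
  rw [← sum_finrank_localization_eq_finrank V C Ω, Nat.cast_sum]
  exact Finset.sum_congr rfl fun 𝔫 _ => length_localization_eq_finrank V C Ω 𝔫

/-! ### §3 The multiplicities indexed by the `Ω`-valued points of `C` -/

omit [Module.Free V C] in
/-- **Points of the geometric fibre = `Ω`-valued points of `C`**: `φ ↦ ker (AlgHom.liftEquiv φ)` is a BIJECTION
`(C →ₐ[V] Ω) → MaximalSpectrum (Ω ⊗[V] C)` (base-change adjunction `(C →ₐ[V] Ω) ≃ (Ω ⊗_V C →ₐ[Ω] Ω)`, Mathlib `AlgHom.liftEquiv`, followed by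
`bijective_kerMax`). [cite: StacksProject, Tag 00U3] -/
theorem bijective_kerMax_liftEquiv :
    Function.Bijective (fun φ : C →ₐ[V] Ω =>
      (⟨RingHom.ker (AlgHom.liftEquiv V Ω C Ω φ), isMaximal_ker_algHom Ω (Ω ⊗[V] C) (AlgHom.liftEquiv V Ω C Ω φ)⟩ :
        MaximalSpectrum (Ω ⊗[V] C))) :=
  (bijective_kerMax Ω (Ω ⊗[V] C)).comp (AlgHom.liftEquiv V Ω C Ω).bijective

/-- **The multiplicities, indexed by the geometric points `φ : C →ₐ[V] Ω`, add up to the rank**: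
`∑ᶠ φ, dim_Ω (Ω ⊗_V C)_{ker φ̃} = rank_V C` (`φ̃ = AlgHom.liftEquiv φ`).  With `e_φ := dim_Ω (Ω ⊗_V C)_{ker φ̃}` (`= ℓ`, §2) these are the
weights of the pull-back `0`-cycle of a point under a finite flat cover; all `e_φ = 1` exactly in the reduced (étale) case.
[cite: Fulton1998, Appendix A.1, Example A.1.1] [cite: StacksProject, Tag 00JA] -/
theorem finsum_finrank_localization_algHom_eq_finrank :
    ∑ᶠ φ : C →ₐ[V] Ω,
      (haveI := (isMaximal_ker_algHom Ω (Ω ⊗[V] C) (AlgHom.liftEquiv V Ω C Ω φ)).isPrime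
       Module.finrank Ω (Localization.AtPrime (RingHom.ker (AlgHom.liftEquiv V Ω C Ω φ)))) = Module.finrank V C := by
  classical
  haveI := finite_maximalSpectrum_tensor V C Ω
  letI : Fintype (MaximalSpectrum (Ω ⊗[V] C)) := Fintype.ofFinite _
  let e : (C →ₐ[V] Ω) ≃ MaximalSpectrum (Ω ⊗[V] C) := Equiv.ofBijective _ (bijective_kerMax_liftEquiv V C Ω)
  haveI : Finite (C →ₐ[V] Ω) := Finite.of_equiv _ e.symm
  letI : Fintype (C →ₐ[V] Ω) := Fintype.ofFinite _
  rw [finsum_eq_sum_of_fintype, ← sum_finrank_localization_eq_finrank V C Ω]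
  exact Fintype.sum_equiv e _ _ fun φ => rfl

end FibreLength

end Literature.RingTheory.Length

end
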